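import Summits.QuantumFields.YangMills.Theorems.UnitScaleTiltProp7SectET3CurvedPropagatorsT3
import HarnessLib

/-!
# Route `UnitScaleTilt`, crux K1 «MinimiserStabilityRegPr» (stmt-QuantumFields-19200), EX row `norm_G` — **(N1) THE (115) → sup DOOR FOR THE READER OF RECORD `frakGfR`.**

Cell `ym3-torus` (HUMAN RULING D-0037; rung R3 = SU(2) YM₃ on T³ — NOT d = 4, NOT infinite volume, NOT a mass gap, NOT Clay).  Free prover hand `ym-line-cst-p1` (gen 36), pen N1 of
★p1 g27 CHAIR WORD №24 «THE NORM_G ROAD» (map: px19 g13 LOCATE-NORMG-ALGEBRA §0∕§3 pen 1; socket shape: namer w2 g12 SOCKET-norm_G-S48).  THEOREMS ONLY (0 `def`, 0 `sorry`,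
default heartbeats); `--supports stmt-QuantumFields-19200 --as helper`; count-neutral.

THE ROW.  The EX display ✓`Prop7StubEXOfChartPiecesTwS47.stubEX_of_chartPiecesTwS47` asks, as its binder `norm_G`, for every member `i : Idx L`, every printed-regular `U₀` below the
cap and under the `Lift` antecedent: `∀ f, ‖frakGfR … (a L i) (DeltaOnePJ …) U₀ f‖ ≤ B₀ L * ‖f‖` — the norm of [Balaban1985Variational] (117) *«By Theorem 3.13 of [5] the norm
max{|·|_{(−1)}, |∇·|_{(−2)}} of the transformation can be estimated by B₀|J|_{(−3)} + …»* for the transformation `𝔊 = G₁𝔓*` of (111)∕[Balaban1985BackgroundPropagators] (3.153),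
read (`frakGfR`, ✓`Prop7SectET3CurvedPropagators`) from the size `|·|_{(−3)}` (`NegSize L η (K−n) 3`) into the space (115) (`Space115 L η (K−n) (K−n) ∇_{U₀}`,
`∇_{U₀} = nabla115 η (bgOfCfg F K U₀)`, `η = L^{−(K−n)}`).

WHAT THIS FILE SAYS (the door; no analysis).  At a member of rung R3's pure small-field problem EVERY WEIGHT OF (115) IS ONE (`(L^{K−n}·L^{−(K−n)})^m = 1`,
✓`Prop7SectET3Transport.levWeight_const_eq_one`∕`norm_negSize_const_eq`), so
* §1 `‖f‖_{(−3)} = ‖f‖_∞` and `‖A‖_{(115)} = max ‖A‖_∞ ‖∇_{U₀}A‖_∞` (`norm_datum_eq`, `norm_space115_eq`);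
* §2 ★ `norm_frakGfR_apply_eq`: **`‖frakGfR … U₀ f‖ = max ‖𝔊g‖_∞ ‖∇_{U₀}(𝔊g)‖_∞`** with `g` the function underlying `f` and `𝔊g := readFun frobEquiv c₀ c₀ (frakGT … U₀) g` = the Hilbert-level
  `𝔊 = frakGT` (✓`jet_frakGfR_eq`) read on the functions;
* §3 ★★ THE DOOR `norm_frakGfR_apply_le_of_sup_letters`: the two sup → sup letters (V) `‖𝔊g‖_∞ ≤ M_V‖g‖_∞` and (∇) `‖∇_{U₀}(𝔊g)‖_∞ ≤ M_∇‖g‖_∞` give `‖frakGfR … f‖ ≤ max M_V M_∇ · ‖f‖`;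
  ★★ `forall_norm_frakGfR_le_iff`: **`norm_G`'s inequality with constant `B` IS EXACTLY the pair of letters with the same `B`**; `opNorm_frakGfR_le_of_sup_letters` (operator-norm form)
  — the lit socket ✓`B11Eq117TransformationNormComp.norm_toCLM115_apply_le_of_comp` at the member, with its three weight factors `w̄₀ = w̄₁ = w̲⁻¹ = 1` already evaluated;
* §4 THE SAME DOOR IN THE ROUTE'S CURRENCY (bond functions `A : PBond (F.P K) 0 → M₂(ℂ)` read by `toL2 F K c₀`; VALUE bondwise in the `‖(toL2⁻¹(B(toL2 X))) b_d‖` currency of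
  O4e∕(K2)∕✓`Prop7KernelRowColumnGauge.colw_apply_le`; GRADIENT as the (115)-sup `‖∇_{U₀}(X ∘ bondEquiv⁻¹)‖_∞` = the conclusion shape of N5 (px5 g13, `Prop7OneFormGradientSupNabla`, the
  `nabla115 ↔ covGradT` dictionary over ✓`Prop7OneFormGradientSup.norm_covGradT_le_of_letters` — NOT restated here)): `readFun_eq_cfgEquiv` (`𝔊g` is `toL2⁻¹(𝔊(toL2 A))` re-indexed
  along ✓`Prop7SectET3Transport.cfgEquiv`, `A := cfgEquiv⁻¹ g`), `cfgEquiv_eq_lambda`, ★★ `norm_frakGfR_apply_le_of_route_letters`, ★★ `forall_norm_frakGfR_le_iff_route`: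
  `(∀ f, ‖frakGfR … f‖ ≤ B‖f‖) ↔ (∀ A b, ‖(toL2⁻¹(𝔊(toL2 A))) b‖ ≤ B‖A‖_∞) ∧ (∀ A, ‖∇_{U₀}((toL2⁻¹(𝔊(toL2 A))) ∘ bondEquiv⁻¹)‖_∞ ≤ B‖A‖_∞)`.
SLOT-GENERIC: every statement holds for an arbitrary Hessian letter `Δx` (so at the display's `DeltaOnePJ … (a L i)` verbatim, and at `DeltaEtaSlot`∕`DeltaPiSlotP` for the twin rows).
HYP-SAT (★★OWNER RULING №42): no `RegPr`∕`Lift`∕cap hypothesis is consumed or displayed here (pure norm bookkeeping at the member; the letters (V)∕(∇) are where the class enters —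
N4∕N5∕N6 of the road); conclusions non-vacuous (equalities and `iff`s); no `Prop` placeholder.
HONEST SCOPE.  Bookkeeping: the (117) norm at a member is the max of two sup norms.  Nothing of the letters (V)∕(∇) for `G₀`∕`G₁`∕`H₁`∕the third word, of `norm_G`, of the eight EX print
rows, `hThm2S`, EX, the crux or the rung is proved here; rung R3 = SU(2) YM₃ on T³ — NOT d = 4, NOT infinite volume, NOT a mass gap, NOT Clay; the Yang–Mills mass gap is NOT proved.

References: T. Bałaban, CMP **102** (1985) 277–309 [Balaban1985Variational] ((19) p.281, (110)–(111) p.294, (115)–(117) pp.294–295); CMP **99** (1985) 389–434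
[Balaban1985BackgroundPropagators] ((3.3) p.391, (3.11) p.392, (3.153) p.426, Thm 3.13 p.426).
-/

set_option autoImplicit false

noncomputable section

open scoped BigOperators Matrix.Norms.L2Operator InnerProductSpace

namespace Summit.QuantumFields.YangMills.Theorems.Prop7FrakGfRNormOfSupLetters

open Literature.MathematicalPhysics.QuantumFieldTheory.Balaban1983to89
open Literature.MathematicalPhysics.QuantumFieldTheory.Balaban1983to89.T3ContinuumYM3Torus
open B9SectCLatticeCarrier (Bond)
open B4Sect5Torus (TSite)
open B9Eq311L2Pairing (WL2)
open B11Eq115Space (NegSize Space115 JetSup NegSup levWeight)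
open B11Eq111FrakG (nabla115)
open B11Eq103H1Complex (BondL2K funEquiv readFun funEquiv_apply readFun_apply)
open Summit.QuantumFields.YangMills.Theorems.Prop7SectET3Transport (periodsT3 siteEquiv bondEquiv cfgEquiv bgOfCfg cfgEquiv_apply cfgEquiv_symm_apply norm_cfgEquiv
  norm_cfgEquiv_symm norm_negSize_const_eq)
open Summit.QuantumFields.YangMills.Theorems.Prop7SectET3HilbertLetters (W₂ frobEquiv toL2 toL2_symm_apply)
open Summit.QuantumFields.YangMills.Theorems.Prop7SectET3CurvedPropagators (frakGT frakGfR jet_frakGfR_eq)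

variable (F : T3Family) (n K : ℕ) (h : n ≤ K) (c₀ cB a : ℝ) [Fact (0 < c₀)] [Fact (0 < cB)]
  (Δx : GaugeField (F.P K) 0 (Matrix.specialUnitaryGroup (Fin 2) ℂ) → (BondL2K ℂ 3 (periodsT3 F K) c₀ W₂ →ₗ[ℂ] BondL2K ℂ 3 (periodsT3 F K) c₀ W₂))
  [Fact (0 < (F.L : ℝ))] [Fact (0 < ((F.L : ℝ)⁻¹) ^ (K - n))]
  (U₀ : GaugeField (F.P K) 0 (Matrix.specialUnitaryGroup (Fin 2) ℂ))

/-! ## §1 At a member the two norms of (117) are sup norms (every weight of (115) is one) -/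

omit [Fact (0 < c₀)] in
/-- **THE SIZE `|·|_{(−3)}` AT THE MEMBER IS THE SUP NORM**: `‖f‖ = ‖g‖_∞` for the function `g` underlying `f` (weights `(L^{K−n}η)³ = 1` at `η = L^{−(K−n)}`).
[cite: Balaban1985Variational, (115) p.294, p.286] -/
theorem norm_datum_eq (f : NegSize (F.L : ℝ) (((F.L : ℝ)⁻¹) ^ (K - n)) (fun _ : Bond 3 (periodsT3 F K) => K - n) 3 (Matrix (Fin 2) (Fin 2) ℂ)) :
    ‖f‖ = ‖NegSup.equiv _ _ f‖ :=
  norm_negSize_const_eq (K - n) 3 f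

omit [Fact (0 < c₀)] in
/-- **THE NORM OF (115) AT THE MEMBER IS `max ‖A‖_∞ ‖∇A‖_∞`** (weights `(L^{K−n}η)¹ = (L^{K−n}η)² = 1`), for any derivative letter `Dc`. [cite: Balaban1985Variational, (115) p.294] -/
theorem norm_space115_eq (Dc : (Bond 3 (periodsT3 F K) → Matrix (Fin 2) (Fin 2) ℂ) →ₗ[ℂ] (Bond 3 (periodsT3 F K) × Fin 3 → Matrix (Fin 2) (Fin 2) ℂ))
    (A : Space115 (F.L : ℝ) (((F.L : ℝ)⁻¹) ^ (K - n)) (fun _ : Bond 3 (periodsT3 F K) => K - n) (fun _ : Bond 3 (periodsT3 F K) × Fin 3 => K - n) Dc) :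
    ‖A‖ = max ‖JetSup.equiv _ _ _ A‖ ‖Dc (JetSup.equiv _ _ _ A)‖ := by
  rw [B11Eq115Space.JetSup.norm_def A, norm_negSize_const_eq (K - n) 1 (JetSup.fst A), norm_negSize_const_eq (K - n) 2 (JetSup.snd A)]
  rfl

/-! ## §2 The reader of record read on the functions, and its (117) norm as a max of two sups -/

/-- The configuration underlying `frakGfR … f` is the Hilbert-level `𝔊 = frakGT … U₀` READ ON THE FUNCTIONS (`readFun frobEquiv c₀ c₀`) applied to the function underlying `f`
(✓`jet_frakGfR_eq`, `readFun_apply`). [cite: Balaban1985Variational, (111) p.294] -/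
theorem equiv_frakGfR_eq_readFun (f : NegSize (F.L : ℝ) (((F.L : ℝ)⁻¹) ^ (K - n)) (fun _ : Bond 3 (periodsT3 F K) => K - n) 3 (Matrix (Fin 2) (Fin 2) ℂ)) :
    JetSup.equiv _ _ _ (frakGfR F n K h c₀ cB a Δx U₀ f) =
      readFun frobEquiv (fun _ : Bond 3 (periodsT3 F K) => c₀) (fun _ : Bond 3 (periodsT3 F K) => c₀) (frakGT F n K h c₀ cB a Δx U₀) (NegSup.equiv _ _ f) := by
  rw [jet_frakGfR_eq, readFun_apply]

/-- ★ **THE (117) NORM OF `frakGfR … f` IS `max ‖𝔊g‖_∞ ‖∇_{U₀}(𝔊g)‖_∞`** (`g` the function underlying `f`, `𝔊g = readFun frobEquiv c₀ c₀ (frakGT … U₀) g`, `∇_{U₀} = nabla115 η (bgOfCfg F K U₀)`).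
[cite: Balaban1985Variational, (115) p.294, (117) p.295] -/
theorem norm_frakGfR_apply_eq (f : NegSize (F.L : ℝ) (((F.L : ℝ)⁻¹) ^ (K - n)) (fun _ : Bond 3 (periodsT3 F K) => K - n) 3 (Matrix (Fin 2) (Fin 2) ℂ)) :
    ‖frakGfR F n K h c₀ cB a Δx U₀ f‖ =
      max ‖readFun frobEquiv (fun _ : Bond 3 (periodsT3 F K) => c₀) (fun _ : Bond 3 (periodsT3 F K) => c₀) (frakGT F n K h c₀ cB a Δx U₀) (NegSup.equiv _ _ f)‖
        ‖nabla115 (((F.L : ℝ)⁻¹) ^ (K - n)) (bgOfCfg F K U₀)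
          (readFun frobEquiv (fun _ : Bond 3 (periodsT3 F K) => c₀) (fun _ : Bond 3 (periodsT3 F K) => c₀) (frakGT F n K h c₀ cB a Δx U₀) (NegSup.equiv _ _ f))‖ := by
  rw [norm_space115_eq, equiv_frakGfR_eq_readFun]

/-! ## §3 The door: `norm_G`'s inequality from — and equivalent to — the two sup → sup letters (V), (∇) -/

/-- ★★ **THE DOOR**: the value letter (V) `‖𝔊g‖_∞ ≤ M_V‖g‖_∞` and the gradient letter (∇) `‖∇_{U₀}(𝔊g)‖_∞ ≤ M_∇‖g‖_∞` for the Hilbert-level `𝔊 = frakGT … U₀` read on the functions give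
`norm_G`'s inequality `‖frakGfR … U₀ f‖ ≤ max M_V M_∇ · ‖f‖` — [5] Thm 3.13's two rows ⟹ (117), at a member (all weights one). ANY slot `Δx`.
[cite: Balaban1985Variational, (117) p.295; Balaban1985BackgroundPropagators, Thm 3.13 p.426] -/
theorem norm_frakGfR_apply_le_of_sup_letters {MV MG : ℝ}
    (hV : ∀ g : Bond 3 (periodsT3 F K) → Matrix (Fin 2) (Fin 2) ℂ,
      ‖readFun frobEquiv (fun _ : Bond 3 (periodsT3 F K) => c₀) (fun _ : Bond 3 (periodsT3 F K) => c₀) (frakGT F n K h c₀ cB a Δx U₀) g‖ ≤ MV * ‖g‖)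
    (hG : ∀ g : Bond 3 (periodsT3 F K) → Matrix (Fin 2) (Fin 2) ℂ,
      ‖nabla115 (((F.L : ℝ)⁻¹) ^ (K - n)) (bgOfCfg F K U₀)
        (readFun frobEquiv (fun _ : Bond 3 (periodsT3 F K) => c₀) (fun _ : Bond 3 (periodsT3 F K) => c₀) (frakGT F n K h c₀ cB a Δx U₀) g)‖ ≤ MG * ‖g‖)
    (f : NegSize (F.L : ℝ) (((F.L : ℝ)⁻¹) ^ (K - n)) (fun _ : Bond 3 (periodsT3 F K) => K - n) 3 (Matrix (Fin 2) (Fin 2) ℂ)) :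
    ‖frakGfR F n K h c₀ cB a Δx U₀ f‖ ≤ max MV MG * ‖f‖ := by
  rw [norm_frakGfR_apply_eq, norm_datum_eq]
  exact max_le ((hV _).trans (mul_le_mul_of_nonneg_right (le_max_left _ _) (norm_nonneg _)))
    ((hG _).trans (mul_le_mul_of_nonneg_right (le_max_right _ _) (norm_nonneg _)))

/-- ★★ **`norm_G` IS EXACTLY THE TWO LETTERS**: `(∀ f, ‖frakGfR … U₀ f‖ ≤ B‖f‖) ↔ ∀ g, ‖𝔊g‖_∞ ≤ B‖g‖_∞ ∧ ‖∇_{U₀}(𝔊g)‖_∞ ≤ B‖g‖_∞` — no loss either way at a member.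
[cite: Balaban1985Variational, (115) p.294, (117) p.295] -/
theorem forall_norm_frakGfR_le_iff (B : ℝ) :
    (∀ f : NegSize (F.L : ℝ) (((F.L : ℝ)⁻¹) ^ (K - n)) (fun _ : Bond 3 (periodsT3 F K) => K - n) 3 (Matrix (Fin 2) (Fin 2) ℂ),
        ‖frakGfR F n K h c₀ cB a Δx U₀ f‖ ≤ B * ‖f‖) ↔
      ∀ g : Bond 3 (periodsT3 F K) → Matrix (Fin 2) (Fin 2) ℂ,
        ‖readFun frobEquiv (fun _ : Bond 3 (periodsT3 F K) => c₀) (fun _ : Bond 3 (periodsT3 F K) => c₀) (frakGT F n K h c₀ cB a Δx U₀) g‖ ≤ B * ‖g‖ ∧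
          ‖nabla115 (((F.L : ℝ)⁻¹) ^ (K - n)) (bgOfCfg F K U₀)
            (readFun frobEquiv (fun _ : Bond 3 (periodsT3 F K) => c₀) (fun _ : Bond 3 (periodsT3 F K) => c₀) (frakGT F n K h c₀ cB a Δx U₀) g)‖ ≤ B * ‖g‖ := by
  refine ⟨fun hf g => ?_, fun hg f => ?_⟩
  · have h1 := hf ((NegSup.equiv _ _).symm g)
    rw [norm_frakGfR_apply_eq, norm_datum_eq, Equiv.apply_symm_apply, max_le_iff] at h1
    exact h1
  · have h1 := norm_frakGfR_apply_le_of_sup_letters F n K h c₀ cB a Δx U₀ (fun g => (hg g).1) (fun g => (hg g).2) f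
    rwa [max_self] at h1

/-- The operator-norm form of the door: `‖frakGfR … U₀‖ ≤ max M_V M_∇` (for `0 ≤ M_V`). [cite: Balaban1985Variational, (117) p.295] -/
theorem opNorm_frakGfR_le_of_sup_letters {MV MG : ℝ} (hMV : 0 ≤ MV)
    (hV : ∀ g : Bond 3 (periodsT3 F K) → Matrix (Fin 2) (Fin 2) ℂ,
      ‖readFun frobEquiv (fun _ : Bond 3 (periodsT3 F K) => c₀) (fun _ : Bond 3 (periodsT3 F K) => c₀) (frakGT F n K h c₀ cB a Δx U₀) g‖ ≤ MV * ‖g‖)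
    (hG : ∀ g : Bond 3 (periodsT3 F K) → Matrix (Fin 2) (Fin 2) ℂ,
      ‖nabla115 (((F.L : ℝ)⁻¹) ^ (K - n)) (bgOfCfg F K U₀)
        (readFun frobEquiv (fun _ : Bond 3 (periodsT3 F K) => c₀) (fun _ : Bond 3 (periodsT3 F K) => c₀) (frakGT F n K h c₀ cB a Δx U₀) g)‖ ≤ MG * ‖g‖) :
    ‖frakGfR F n K h c₀ cB a Δx U₀‖ ≤ max MV MG :=
  ContinuousLinearMap.opNorm_le_bound _ (le_max_of_le_left hMV) (norm_frakGfR_apply_le_of_sup_letters F n K h c₀ cB a Δx U₀ hV hG)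

/-! ## §4 The same door in the route's currency: `toL2`, bond functions on `PBond (F.P K) 0`; the gradient letter in N5's (115)-sup shape -/

omit [Fact (0 < c₀)] [Fact (0 < (F.L : ℝ))] [Fact (0 < ((F.L : ℝ)⁻¹) ^ (K - n))] in
/-- `toL2 A` is `funEquiv⁻¹` of the re-indexed bond function `cfgEquiv F K _ A` (unfolding ✓`Prop7SectET3HilbertLetters.toL2`). [cite: Balaban1985BackgroundPropagators, (3.11) p.392] -/
theorem toL2_eq_funEquiv_symm_cfgEquiv (A : PBond (F.P K) 0 → Matrix (Fin 2) (Fin 2) ℂ) :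
    toL2 F K c₀ A = (funEquiv frobEquiv (fun _ : Bond 3 (periodsT3 F K) => c₀)).symm (cfgEquiv F K _ A) := rfl

omit [Fact (0 < c₀)] [Fact (0 < (F.L : ℝ))] [Fact (0 < ((F.L : ℝ)⁻¹) ^ (K - n))] in
/-- **A HILBERT-LEVEL OPERATOR READ ON THE [B9]-INDEXED FUNCTIONS IS ITS ROUTE READING `toL2⁻¹ ∘ T ∘ toL2`, RE-INDEXED**: `readFun frobEquiv c₀ c₀ T g = cfgEquiv (toL2⁻¹ (T (toL2 (cfgEquiv⁻¹ g))))`.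
[cite: Balaban1985BackgroundPropagators, (3.11) p.392] -/
theorem readFun_eq_cfgEquiv (T : BondL2K ℂ 3 (periodsT3 F K) c₀ W₂ →ₗ[ℂ] BondL2K ℂ 3 (periodsT3 F K) c₀ W₂) (g : Bond 3 (periodsT3 F K) → Matrix (Fin 2) (Fin 2) ℂ) :
    readFun frobEquiv (fun _ : Bond 3 (periodsT3 F K) => c₀) (fun _ : Bond 3 (periodsT3 F K) => c₀) T g =
      cfgEquiv F K _ ((toL2 F K c₀).symm (T (toL2 F K c₀ ((cfgEquiv F K (Matrix (Fin 2) (Fin 2) ℂ)).symm g)))) := by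
  funext p
  rw [readFun_apply, funEquiv_apply, cfgEquiv_apply, toL2_symm_apply, Equiv.apply_symm_apply, toL2_eq_funEquiv_symm_cfgEquiv, Equiv.apply_symm_apply]

omit [Fact (0 < c₀)] [Fact (0 < (F.L : ℝ))] [Fact (0 < ((F.L : ℝ)⁻¹) ^ (K - n))] in
/-- The tree's configuration transport `cfgEquiv F K _ X` IS the lambda `fun q ↦ X ((bondEquiv F K)⁻¹ q)` (the spelling of N5 ✓`Prop7OneFormGradientSupNabla`'s (∇) letters). [folklore] -/
theorem cfgEquiv_eq_lambda (X : PBond (F.P K) 0 → Matrix (Fin 2) (Fin 2) ℂ) :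
    cfgEquiv F K (Matrix (Fin 2) (Fin 2) ℂ) X = fun q : Bond 3 (periodsT3 F K) => X ((bondEquiv F K).symm q) := rfl

/-- ★★ **THE DOOR IN THE ROUTE'S CURRENCY**: with `X_A := toL2⁻¹(𝔊(toL2 A))` (`𝔊 = frakGT … U₀`, `A : PBond (F.P K) 0 → M₂(ℂ)`), the bondwise VALUE letter `‖X_A b‖ ≤ M_V‖A‖_∞` (the
`‖(toL2⁻¹(B(toL2 X))) b_d‖` currency of O4e∕(K2)∕✓`Prop7KernelRowColumnGauge.colw_apply_le`) and the (115)-GRADIENT letter `‖∇_{U₀}(X_A ∘ bondEquiv⁻¹)‖_∞ ≤ M_∇‖A‖_∞` (the conclusion shape of N5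
`Prop7OneFormGradientSupNabla.norm_nabla115_bgOfCfg_le_of_letters'` over ✓`Prop7OneFormGradientSup.norm_covGradT_le_of_letters`) give `norm_G`'s inequality `‖frakGfR … U₀ f‖ ≤ max M_V M_∇ · ‖f‖`.
ANY slot `Δx`. [cite: Balaban1985Variational, (117) p.295, (19) p.281; Balaban1985BackgroundPropagators, Thm 3.13 p.426] -/
theorem norm_frakGfR_apply_le_of_route_letters {MV MG : ℝ} (hMV : 0 ≤ MV)
    (hV : ∀ (A : PBond (F.P K) 0 → Matrix (Fin 2) (Fin 2) ℂ) (b : PBond (F.P K) 0),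
      ‖(toL2 F K c₀).symm (frakGT F n K h c₀ cB a Δx U₀ (toL2 F K c₀ A)) b‖ ≤ MV * ‖A‖)
    (hG : ∀ A : PBond (F.P K) 0 → Matrix (Fin 2) (Fin 2) ℂ,
      ‖nabla115 (((F.L : ℝ)⁻¹) ^ (K - n)) (bgOfCfg F K U₀)
          (fun q : Bond 3 (periodsT3 F K) => (toL2 F K c₀).symm (frakGT F n K h c₀ cB a Δx U₀ (toL2 F K c₀ A)) ((bondEquiv F K).symm q))‖ ≤ MG * ‖A‖)
    (f : NegSize (F.L : ℝ) (((F.L : ℝ)⁻¹) ^ (K - n)) (fun _ : Bond 3 (periodsT3 F K) => K - n) 3 (Matrix (Fin 2) (Fin 2) ℂ)) :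
    ‖frakGfR F n K h c₀ cB a Δx U₀ f‖ ≤ max MV MG * ‖f‖ := by
  refine norm_frakGfR_apply_le_of_sup_letters F n K h c₀ cB a Δx U₀ (fun g => ?_) (fun g => ?_) f
  · rw [readFun_eq_cfgEquiv, ← norm_cfgEquiv_symm F K g]
    exact (pi_norm_le_iff_of_nonneg (mul_nonneg hMV (norm_nonneg _))).2 fun p => by
      rw [cfgEquiv_apply]
      exact hV _ _
  · rw [readFun_eq_cfgEquiv, ← norm_cfgEquiv_symm F K g, cfgEquiv_eq_lambda]
    exact hG _

/-- ★★ **`norm_G` IS EXACTLY THE TWO ROUTE LETTERS**: `(∀ f, ‖frakGfR … U₀ f‖ ≤ B‖f‖) ↔ (∀ A b, ‖X_A b‖ ≤ B‖A‖_∞) ∧ ∀ A, ‖∇_{U₀}(X_A ∘ bondEquiv⁻¹)‖_∞ ≤ B‖A‖_∞`, `X_A := toL2⁻¹(𝔊(toL2 A))`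
(`0 ≤ B`; no loss either way at a member). [cite: Balaban1985Variational, (115) p.294, (117) p.295] -/
theorem forall_norm_frakGfR_le_iff_route {B : ℝ} (hB : 0 ≤ B) :
    (∀ f : NegSize (F.L : ℝ) (((F.L : ℝ)⁻¹) ^ (K - n)) (fun _ : Bond 3 (periodsT3 F K) => K - n) 3 (Matrix (Fin 2) (Fin 2) ℂ),
        ‖frakGfR F n K h c₀ cB a Δx U₀ f‖ ≤ B * ‖f‖) ↔
      (∀ (A : PBond (F.P K) 0 → Matrix (Fin 2) (Fin 2) ℂ) (b : PBond (F.P K) 0),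
          ‖(toL2 F K c₀).symm (frakGT F n K h c₀ cB a Δx U₀ (toL2 F K c₀ A)) b‖ ≤ B * ‖A‖) ∧
        ∀ A : PBond (F.P K) 0 → Matrix (Fin 2) (Fin 2) ℂ,
          ‖nabla115 (((F.L : ℝ)⁻¹) ^ (K - n)) (bgOfCfg F K U₀)
              (fun q : Bond 3 (periodsT3 F K) => (toL2 F K c₀).symm (frakGT F n K h c₀ cB a Δx U₀ (toL2 F K c₀ A)) ((bondEquiv F K).symm q))‖ ≤ B * ‖A‖ := by
  refine ⟨fun hf => ?_, fun hA f => ?_⟩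
  · -- read the lit letters at `g := cfgEquiv A`
    have hg := (forall_norm_frakGfR_le_iff F n K h c₀ cB a Δx U₀ B).1 hf
    have hX : ∀ A : PBond (F.P K) 0 → Matrix (Fin 2) (Fin 2) ℂ,
        readFun frobEquiv (fun _ : Bond 3 (periodsT3 F K) => c₀) (fun _ : Bond 3 (periodsT3 F K) => c₀) (frakGT F n K h c₀ cB a Δx U₀) (cfgEquiv F K _ A) =
          cfgEquiv F K _ ((toL2 F K c₀).symm (frakGT F n K h c₀ cB a Δx U₀ (toL2 F K c₀ A))) := fun A => by
      rw [readFun_eq_cfgEquiv, Equiv.symm_apply_apply]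
    refine ⟨fun A b => ?_, fun A => ?_⟩
    · have h1 := (hg (cfgEquiv F K _ A)).1
      rw [hX, norm_cfgEquiv, norm_cfgEquiv] at h1
      exact (norm_le_pi_norm _ b).trans h1
    · have h1 := (hg (cfgEquiv F K _ A)).2
      rwa [hX, norm_cfgEquiv, cfgEquiv_eq_lambda] at h1
  · have h1 := norm_frakGfR_apply_le_of_route_letters F n K h c₀ cB a Δx U₀ hB hA.1 hA.2 f
    rwa [max_self] at h1

end Summit.QuantumFields.YangMills.Theorems.Prop7FrakGfRNormOfSupLetters

end
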